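import Summits.AnomalousDissipation.AnomalousDissipation.Theorems.GenericRunawayStokesScaling.Negative.Frame

/-!
# Negative knowledge for the crux `MirrorVariety.GenericRunawayStokesScaling` (stmt-AnomalousDissipation-2990), II:
# what `fderiv` in the regularity hypothesis IS

Certified copy of §7 of the cdisprove work file.  `F(c, ν) = -ν A c + Π(ĝ - B(c,c))` is a polynomial of degree
two on `(↥S → (EuclideanSpace ℂ (Fin 3))) × ℝ`; `hasFDerivAt_Fmap`: its derivative is `DF(c,ν)(v,t) = -t A c - ν A v - Π(B(c,v) + B(v,c))`
(exact quadratic Taylor remainder `Fmap_taylor`, bound `norm_remFun_le`); `fderiv_galerkinRHS_apply` rewrites the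
crux's `fderiv`, and `regular_iff` turns its regularity hypothesis into explicit linear algebra, for EVERY finite
frequency set `S`.  Supports stmt-AnomalousDissipation-2990 (and stmt-2989, same hypothesis).
-/

set_option linter.dupNamespace false

noncomputable section

open scoped BigOperators InnerProductSpace ComplexConjugate
open Filter Set Function

namespace Summit.AnomalousDissipation.AnomalousDissipation.Theorems.GenericRunawayStokesScaling.Negative

open Literature.Analysis.FunctionSpaces Literature.Analysis.FunctionSpaces.Torus
open Literature.Analysis.FluidPDE Literature.Analysis.FluidPDE.Torus
open Summit.AnomalousDissipation.AnomalousDissipation.Theses.MirrorVariety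

/-! ## §7 What `fderiv` in the regularity hypothesis IS: the derivative of the Galerkin field

`F(c, ν) = -ν A c + Π(ĝ - B(c,c))` is a polynomial of degree two on `(↥S → (EuclideanSpace ℂ (Fin 3))) × ℝ`, so
`DF(c,ν)(v,t) = -t A c - ν A v - Π(B(c,v) + B(v,c))` with the EXACT Taylor remainder
`F(z+h) - F(z) - DF(z)h = -t A v - Π B(v,v)`, `‖·‖ ≤ K_S ‖h‖²`.  We build `DF(z)` as a continuous linear
map, prove `HasFDerivAt`, and rewrite the crux's `Regular` into an explicit linear-algebra condition
(valid for EVERY finite frequency set `S`, so it also serves `MirrorDisconnection`). -/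

section Deriv

variable {S : Finset (Fin 3 → ℤ)}

/-- Stokes weight `C_k = 4π²|k|²`. [folklore] -/
abbrev stokesW (k : Fin 3 → ℤ) : ℝ := 4 * Real.pi ^ 2 * freqNormSq k

/-- Stokes weights are nonnegative. [folklore] -/
theorem stokesW_nonneg (k : Fin 3 → ℤ) : 0 ≤ stokesW k := by
  have := freqNormSq_nonneg k
  simp only [stokesW]; positivity

/-- Real scalars act on `(EuclideanSpace ℂ (Fin 3))` through `ℝ ⊂ ℂ` (definitional). [folklore] -/
theorem real_smul_vec (a : ℝ) (x : (EuclideanSpace ℂ (Fin 3))) : a • x = (a : ℂ) • x := rfl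

/-- The map differentiated in the crux: `p = (c, ν) ↦ F(c, ν) = galerkinRHS S ν g c`. [folklore] -/
def Fmap (S : Finset (Fin 3 → ℤ)) (g : ↥S → (EuclideanSpace ℂ (Fin 3))) (p : (↥S → (EuclideanSpace ℂ (Fin 3))) × ℝ) : ↥S → (EuclideanSpace ℂ (Fin 3)) :=
  galerkinRHS S p.2 g p.1

/-- The crux differentiates `Fmap`. [folklore] -/
theorem Fmap_eq (S : Finset (Fin 3 → ℤ)) (g : ↥S → (EuclideanSpace ℂ (Fin 3))) :
    (fun p : (↥S → (EuclideanSpace ℂ (Fin 3))) × ℝ => galerkinRHS S p.2 g p.1) = Fmap S g := rfl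

/-- The Stokes operator `(A c)_k = 4π²|k|² c_k`. [folklore] -/
def stokesA (S : Finset (Fin 3 → ℤ)) (c : ↥S → (EuclideanSpace ℂ (Fin 3))) : ↥S → (EuclideanSpace ℂ (Fin 3)) :=
  fun k => ((stokesW (k : Fin 3 → ℤ) : ℝ) : ℂ) • c k

/-- The Leray-projected quadratic symbol `Q_S(c, v)_k = Π_k B(c̄, v̄)_k` on `S`. [folklore] -/
def projB (S : Finset (Fin 3 → ℤ)) (c v : ↥S → (EuclideanSpace ℂ (Fin 3))) : ↥S → (EuclideanSpace ℂ (Fin 3)) :=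
  fun k => leraySym (k : Fin 3 → ℤ) (convectionCoeff S (coeffExt S c) (coeffExt S v) k)

/-- The linearised nonlinearity `L_c v = Π(B(c,v) + B(v,c))`. [folklore] -/
def symB (S : Finset (Fin 3 → ℤ)) (c v : ↥S → (EuclideanSpace ℂ (Fin 3))) : ↥S → (EuclideanSpace ℂ (Fin 3)) := projB S c v + projB S v c

/-- **The derivative of `F` at `z = (c, ν)` in the direction `h = (v, t)`**:
`DF(c,ν)(v,t) = -t A c - ν A v - Π(B(c,v) + B(v,c))`. [folklore] -/
def derivFun (S : Finset (Fin 3 → ℤ)) (z h : (↥S → (EuclideanSpace ℂ (Fin 3))) × ℝ) : ↥S → (EuclideanSpace ℂ (Fin 3)) :=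
  -(h.2 • stokesA S z.1) - z.2 • stokesA S h.1 - symB S z.1 h.1

/-- The exact second-order Taylor remainder `R(h) = -t A v - Π B(v,v)`. [folklore] -/
def remFun (S : Finset (Fin 3 → ℤ)) (h : (↥S → (EuclideanSpace ℂ (Fin 3))) × ℝ) : ↥S → (EuclideanSpace ℂ (Fin 3)) :=
  -(h.2 • stokesA S h.1) - projB S h.1 h.1

/-- `A` is additive. [folklore] -/
theorem stokesA_add (c c' : ↥S → (EuclideanSpace ℂ (Fin 3))) : stokesA S (c + c') = stokesA S c + stokesA S c' := by
  funext k; simp [stokesA, smul_add]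

/-- `A` is real-homogeneous. [folklore] -/
theorem stokesA_smul (a : ℝ) (c : ↥S → (EuclideanSpace ℂ (Fin 3))) : stokesA S (a • c) = a • stokesA S c := by
  funext k
  simp only [stokesA, Pi.smul_apply, real_smul_vec, smul_smul, mul_comm]

/-- `A 0 = 0`. [folklore] -/
theorem stokesA_zero : stokesA S (0 : ↥S → (EuclideanSpace ℂ (Fin 3))) = 0 := by
  funext k; simp [stokesA]

/-- `Q_S` is additive on the left. [folklore] -/
theorem projB_add_left (c c' v : ↥S → (EuclideanSpace ℂ (Fin 3))) : projB S (c + c') v = projB S c v + projB S c' v := by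
  funext k; simp only [projB, coeffExt_add, convectionCoeff_add_left, leraySym_add, Pi.add_apply]

/-- `Q_S` is additive on the right. [folklore] -/
theorem projB_add_right (c v v' : ↥S → (EuclideanSpace ℂ (Fin 3))) : projB S c (v + v') = projB S c v + projB S c v' := by
  funext k; simp only [projB, coeffExt_add, convectionCoeff_add_right, leraySym_add, Pi.add_apply]

/-- `Q_S` is real-homogeneous on the left. [folklore] -/
theorem projB_smul_left (a : ℝ) (c v : ↥S → (EuclideanSpace ℂ (Fin 3))) : projB S (a • c) v = a • projB S c v := by
  funext k
  simp only [projB, Pi.smul_apply]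
  rw [coeffExt_smul, real_smul_coeff, convectionCoeff_smul_left, leraySym_smul]
  rfl

/-- `Q_S` is real-homogeneous on the right. [folklore] -/
theorem projB_smul_right (a : ℝ) (c v : ↥S → (EuclideanSpace ℂ (Fin 3))) : projB S c (a • v) = a • projB S c v := by
  funext k
  simp only [projB, Pi.smul_apply]
  rw [coeffExt_smul, real_smul_coeff, convectionCoeff_smul_right, leraySym_smul]
  rfl

/-- `Q_S(0, v) = 0`. [folklore] -/
theorem projB_zero_left (v : ↥S → (EuclideanSpace ℂ (Fin 3))) : projB S 0 v = 0 := by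
  funext k; simp [projB]

/-- `Q_S(c, 0) = 0`. [folklore] -/
theorem projB_zero_right (c : ↥S → (EuclideanSpace ℂ (Fin 3))) : projB S c 0 = 0 := by
  funext k; simp [projB]

/-- `L_c` is additive. [folklore] -/
theorem symB_add_right (c v v' : ↥S → (EuclideanSpace ℂ (Fin 3))) : symB S c (v + v') = symB S c v + symB S c v' := by
  simp only [symB, projB_add_left, projB_add_right]; abel

/-- `L_c` is real-homogeneous. [folklore] -/
theorem symB_smul_right (a : ℝ) (c v : ↥S → (EuclideanSpace ℂ (Fin 3))) : symB S c (a • v) = a • symB S c v := by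
  simp only [symB, projB_smul_left, projB_smul_right, smul_add]

/-- `L_0 = 0`. [folklore] -/
theorem symB_zero_left (v : ↥S → (EuclideanSpace ℂ (Fin 3))) : symB S 0 v = 0 := by
  simp [symB, projB_zero_left, projB_zero_right]

/-- `F` in terms of the pieces: `F(c, ν) = -ν A c + Π ĝ - Q_S(c, c)`. [folklore] -/
theorem Fmap_apply (g : ↥S → (EuclideanSpace ℂ (Fin 3))) (p : (↥S → (EuclideanSpace ℂ (Fin 3))) × ℝ) :
    Fmap S g p = -(p.2 • stokesA S p.1) + (fun k : ↥S => leraySym (k : Fin 3 → ℤ) (g k)) - projB S p.1 p.1 := by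
  funext k
  simp only [Fmap, galerkinRHS_apply, galerkinField_def, coeffExt_coe, leraySym_sub, Pi.add_apply,
    Pi.sub_apply, Pi.neg_apply, Pi.smul_apply, stokesA, projB, real_smul_vec, smul_smul,
    Complex.ofReal_mul]
  abel

/-- **Exact Taylor expansion of degree two**: `F(z + h) - F(z) - DF(z)h = R(h)`. [folklore] -/
theorem Fmap_taylor (g : ↥S → (EuclideanSpace ℂ (Fin 3))) (z h : (↥S → (EuclideanSpace ℂ (Fin 3))) × ℝ) :
    Fmap S g (z + h) - Fmap S g z - derivFun S z h = remFun S h := by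
  rw [Fmap_apply, Fmap_apply]
  simp only [derivFun, remFun, symB, Prod.fst_add, Prod.snd_add, stokesA_add, projB_add_left,
    projB_add_right, add_smul, smul_add]
  abel

/-- The constant of the remainder bound: `K_S = 4π² ∑_{m∈S} |m|² + 2π · #S · ∑_{m∈S} ∑ⱼ |mⱼ|`. [folklore] -/
def remK (S : Finset (Fin 3 → ℤ)) : ℝ :=
  4 * Real.pi ^ 2 * ∑ m ∈ S, freqNormSq m + 2 * Real.pi * (S.card * ∑ m ∈ S, ∑ j, |(m j : ℝ)|)

/-- `K_S ≥ 0`. [folklore] -/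
theorem remK_nonneg (S : Finset (Fin 3 → ℤ)) : 0 ≤ remK S := by
  have h1 : 0 ≤ ∑ m ∈ S, freqNormSq m := Finset.sum_nonneg fun m _ => freqNormSq_nonneg m
  have h2 : 0 ≤ ∑ m ∈ S, ∑ j, |(m j : ℝ)| :=
    Finset.sum_nonneg fun m _ => Finset.sum_nonneg fun j _ => abs_nonneg _
  simp only [remK]; positivity

/-- A single Stokes weight is bounded by the sum over `S`. [folklore] -/
theorem stokesW_le_of_mem {k : Fin 3 → ℤ} (hk : k ∈ S) : stokesW k ≤ 4 * Real.pi ^ 2 * ∑ m ∈ S, freqNormSq m := by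
  simp only [stokesW]
  gcongr
  exact Finset.single_le_sum (f := fun m => freqNormSq m) (fun m _ => freqNormSq_nonneg m) hk

/-- Coordinates of the Stokes operator are bounded: `‖(A c)_k‖ ≤ 4π²(∑|m|²) ‖c‖`. [folklore] -/
theorem norm_stokesA_apply_le (c : ↥S → (EuclideanSpace ℂ (Fin 3))) (k : ↥S) :
    ‖stokesA S c k‖ ≤ (4 * Real.pi ^ 2 * ∑ m ∈ S, freqNormSq m) * ‖c‖ := by
  simp only [stokesA]
  rw [norm_smul, Complex.norm_real, Real.norm_of_nonneg (stokesW_nonneg _)]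
  exact mul_le_mul (stokesW_le_of_mem k.2) (norm_le_pi_norm c k) (norm_nonneg _)
    (by have := Finset.sum_nonneg fun m (_ : m ∈ S) => freqNormSq_nonneg m; positivity)

/-- Coordinates of the projected symbol are bounded: `‖Q_S(c,v)_k‖ ≤ 2π #S (∑∑|mⱼ|) ‖c‖ ‖v‖`. [folklore] -/
theorem norm_projB_apply_le (c v : ↥S → (EuclideanSpace ℂ (Fin 3))) (k : ↥S) :
    ‖projB S c v k‖ ≤ 2 * Real.pi * (S.card * ∑ m ∈ S, ∑ j, |(m j : ℝ)|) * ‖c‖ * ‖v‖ := by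
  simp only [projB]
  exact (norm_leraySym_le _ _).trans
    (norm_convectionCoeff_le S (fun l _ => norm_coeffExt_le c l) (fun m _ => norm_coeffExt_le v m) k)

/-- **Remainder bound**: `‖R(h)‖ ≤ K_S ‖h‖²`. [folklore] -/
theorem norm_remFun_le (h : (↥S → (EuclideanSpace ℂ (Fin 3))) × ℝ) : ‖remFun S h‖ ≤ remK S * ‖h‖ ^ 2 := by
  have h1 : ‖h.1‖ ≤ ‖h‖ := norm_fst_le h
  have h2 : ‖h.2‖ ≤ ‖h‖ := norm_snd_le h
  have hK1 : 0 ≤ 4 * Real.pi ^ 2 * ∑ m ∈ S, freqNormSq m := by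
    have := Finset.sum_nonneg fun m (_ : m ∈ S) => freqNormSq_nonneg m; positivity
  have hK2 : 0 ≤ 2 * Real.pi * (S.card * ∑ m ∈ S, ∑ j, |(m j : ℝ)|) := by
    have : 0 ≤ ∑ m ∈ S, ∑ j, |(m j : ℝ)| :=
      Finset.sum_nonneg fun m _ => Finset.sum_nonneg fun j _ => abs_nonneg _
    positivity
  refine (pi_norm_le_iff_of_nonneg (by have := remK_nonneg S; positivity)).2 fun k => ?_
  simp only [remFun, Pi.sub_apply, Pi.neg_apply, Pi.smul_apply]
  calc ‖-(h.2 • stokesA S h.1 k) - projB S h.1 h.1 k‖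
      ≤ ‖h.2 • stokesA S h.1 k‖ + ‖projB S h.1 h.1 k‖ := by
        rw [sub_eq_add_neg]; exact (norm_add_le _ _).trans (by rw [norm_neg, norm_neg])
    _ ≤ ‖h‖ * ((4 * Real.pi ^ 2 * ∑ m ∈ S, freqNormSq m) * ‖h‖) +
          2 * Real.pi * (S.card * ∑ m ∈ S, ∑ j, |(m j : ℝ)|) * ‖h‖ * ‖h‖ := by
        gcongr
        · rw [norm_smul]
          exact mul_le_mul h2 ((norm_stokesA_apply_le h.1 k).trans (by gcongr)) (norm_nonneg _)
            (norm_nonneg _)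
        · exact (norm_projB_apply_le h.1 h.1 k).trans (by gcongr)
    _ = remK S * ‖h‖ ^ 2 := by simp only [remK]; ring

/-- `DF(z)` is additive in the direction. [folklore] -/
theorem derivFun_add (z h h' : (↥S → (EuclideanSpace ℂ (Fin 3))) × ℝ) :
    derivFun S z (h + h') = derivFun S z h + derivFun S z h' := by
  simp only [derivFun, Prod.fst_add, Prod.snd_add, stokesA_add, symB_add_right, add_smul, smul_add]
  abel

/-- `DF(z)` is homogeneous in the direction. [folklore] -/
theorem derivFun_smul (z : (↥S → (EuclideanSpace ℂ (Fin 3))) × ℝ) (a : ℝ) (h : (↥S → (EuclideanSpace ℂ (Fin 3))) × ℝ) :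
    derivFun S z (a • h) = a • derivFun S z h := by
  simp only [derivFun, Prod.smul_fst, Prod.smul_snd, smul_eq_mul, stokesA_smul, symB_smul_right,
    mul_smul, smul_sub, smul_neg, smul_comm z.2 a]

/-- `DF(z)` as a linear map. [folklore] -/
def derivLin (S : Finset (Fin 3 → ℤ)) (z : (↥S → (EuclideanSpace ℂ (Fin 3))) × ℝ) : ((↥S → (EuclideanSpace ℂ (Fin 3))) × ℝ) →ₗ[ℝ] (↥S → (EuclideanSpace ℂ (Fin 3))) where
  toFun := derivFun S z
  map_add' := derivFun_add z
  map_smul' := derivFun_smul z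

/-- `DF(z)` as a continuous linear map (finite dimensions). [folklore] -/
def derivCLM (S : Finset (Fin 3 → ℤ)) (z : (↥S → (EuclideanSpace ℂ (Fin 3))) × ℝ) : ((↥S → (EuclideanSpace ℂ (Fin 3))) × ℝ) →L[ℝ] (↥S → (EuclideanSpace ℂ (Fin 3))) :=
  LinearMap.toContinuousLinearMap (derivLin S z)

/-- `DF(z)` acts as `derivFun`. [folklore] -/
@[simp] theorem derivCLM_apply (z h : (↥S → (EuclideanSpace ℂ (Fin 3))) × ℝ) : derivCLM S z h = derivFun S z h := rfl

/-- **`F` is differentiable with derivative `DF`** (little-o from the quadratic remainder bound). [folklore] -/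
theorem hasFDerivAt_Fmap (g : ↥S → (EuclideanSpace ℂ (Fin 3))) (z : (↥S → (EuclideanSpace ℂ (Fin 3))) × ℝ) :
    HasFDerivAt (Fmap S g) (derivCLM S z) z := by
  rw [hasFDerivAt_iff_isLittleO_nhds_zero, Asymptotics.isLittleO_iff]
  intro ε hε
  have hK : 0 < remK S + 1 := by have := remK_nonneg S; linarith
  filter_upwards [Metric.ball_mem_nhds (0 : (↥S → (EuclideanSpace ℂ (Fin 3))) × ℝ) (div_pos hε hK)] with h hh
  rw [Metric.mem_ball, dist_zero_right] at hh
  rw [derivCLM_apply, Fmap_taylor]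
  calc ‖remFun S h‖ ≤ remK S * ‖h‖ ^ 2 := norm_remFun_le h
    _ ≤ (remK S + 1) * ‖h‖ * ‖h‖ := by
        rw [sq, ← mul_assoc]; gcongr; linarith
    _ ≤ ε * ‖h‖ := by
        refine mul_le_mul_of_nonneg_right ?_ (norm_nonneg _)
        rw [← le_div_iff₀' hK]; exact hh.le

/-- **The `fderiv` of the crux, computed**: for every finite `S`, force `g`, point `z = (c, ν)` and
direction `h = (v, t)`,
`fderiv ℝ (p ↦ galerkinRHS S p.2 g p.1) z (v, t) = -t A c - ν A v - Π(B(c,v) + B(v,c))`. [folklore] -/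
theorem fderiv_galerkinRHS_apply (g : ↥S → (EuclideanSpace ℂ (Fin 3))) (z h : (↥S → (EuclideanSpace ℂ (Fin 3))) × ℝ) :
    fderiv ℝ (fun p : (↥S → (EuclideanSpace ℂ (Fin 3))) × ℝ => galerkinRHS S p.2 g p.1) z h = derivFun S z h := by
  rw [Fmap_eq, (hasFDerivAt_Fmap g z).fderiv, derivCLM_apply]

/-- **The regularity hypothesis, made explicit**: `Regular S g` iff at every zero `(c, ν)` the linear
map `(v, t) ↦ -t A c - ν A v - Π(B(c,v) + B(v,c))` maps `galerkinSubspace S × ℝ` onto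
`galerkinSubspace S`. [folklore] -/
theorem regular_iff (g : ↥S → (EuclideanSpace ℂ (Fin 3))) :
    Regular S g ↔ ∀ z ∈ variety S g, ∀ w ∈ galerkinSubspace S, ∃ v ∈ galerkinSubspace S, ∃ t : ℝ,
      derivFun S z (v, t) = w := by
  simp only [Regular, fderiv_galerkinRHS_apply]

end Deriv


end Summit.AnomalousDissipation.AnomalousDissipation.Theorems.GenericRunawayStokesScaling.Negative
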